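import Summits.QuantumFields.YangMills.Theorems.BalabanUVNodesN13RStepSubIdentityOfDeadSelAtRecord13CoPH
import Summits.QuantumFields.YangMills.Theorems.BalabanUVNodesN11TkOpMeasurable
import Literature.MathematicalPhysics.QuantumFieldTheory.Balaban1983to89.B16RLeafRecord13SepCoPHSelLaws
import Summits.QuantumFields.YangMills.Theorems.BalabanUVNodesN13U1PieceTowerAtRecord13CoPH

/-!
# BalabanUVNodes ∕ N13 — UNDER THE SELECTOR LAW (ii) AS TYPED, THE DENSITY OF RECORD LIES BELOW THE ITERATED ONE-STEP TRANSPORT OF `ρ₀` AT EVERY FIELD: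
# `ρ_k(V) ≤ (T_{k−1} ∘ ⋯ ∘ T_0)(ρ₀)(V)` — the EXPANSION-FREE form of what the (UV₁₃) upper half asks at the parameters K1⁷'s N13 node files cover: an everywhere bound on (a version of)
# the `k`-fold BLOCK-AVERAGED Wilson–Gibbs density — and, with selector law (i) too, `ρ_k =ᵃᵉ` that iterated transport (Track A, DAG node N13 = [B16]; cluster K1 — K1⁷ `StabilityBAtRecordR13SepCoPH` = stmt-QuantumFields-20542, helper; seat
# `pub-ymgap-dag-n13-w3` g3, sequel of p613238 (`𝐓ρ_k = T_k(ρ_k)`) and `…N13RStepSubIdentityOfDeadSelAtRecord13CoPH` (`ρ_{k+1} ≤ 𝐓ρ_k` under law (ii)); 2026-08-28; count-neutral)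

HONEST FRAMING.  Count-neutral kernel BOOKKEEPING; nothing of Bałaban's is asserted.  The two companions give, for every parameter with `Provisos₁₃CoPH` and the tree's selector law (ii)
AS TYPED (`hdead`, the hypothesis of p583899 ∕ p604459 ∕ p610463), the one-step domination `ρ_{j+1}(V′) ≤ T_j(ρ_j)(V′)` at every field (under the row «level-`j` history terms measurable and
bounded»).  THIS FILE iterates it: with def-T's one-step transports `T_j = transportOfRecord … j` (marginal density × conditional-law integral along Bałaban's block averaging of record)
and the ITERATED TRANSPORT OF `ρ₀` — written out as the `Nat.rec` term `I_0 := ρ₀`, `I_{j+1} := T_j(I_j)` (no new definition) —: (§1) `I_j` is measurable (dag-n11's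
`measurable_kernelTransport`, by induction), non-negative, and bounded by `e^{−E(P)}·Π_{i<j} D_i` under everywhere marginal-density VERSION bounds `D_i` (p607601's domination) — §2 ∕ §3
ask only SOME everywhere bound `B_j` on each `I_j`, `j < k` (the row that makes every fibre integral meaningful at every coarse field; an ultraviolet-stability bound on `I_j` serves); (§2) ★★★ `ρ_k(V) ≤ I_k(V)` AT EVERY FIELD for `k ≤ K`, by induction: `ρ_{j+1} ≤ T_j(ρ_j)` (companion) `≤ T_j(I_j)`
(monotonicity of the transport on `0 ≤ ρ_j ≤ I_j`, `I_j` bounded measurable), the term row being DISCHARGED along the way from `ρ_j ≤ I_j ≤ e^{−E(P)}·Π D_i` (terms `≥ 0` sum to `ρ_j`)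
except for MEASURABILITY of the history terms (displayed; K0c's theorem under (H-U)).  WHAT THIS SAYS (LOCATED, by name): `I_k` is a version of the density of the `k`-fold block-averaged
Gibbs measure `(avg_{k−1} ∘ ⋯ ∘ avg_0)_*(ρ₀·dU)` w.r.t. product Haar (each `T_j` is an `IsRT` version, def-T `isRT_transportOfRecord`); so at the parameters the node files cover, the
(UV₁₃) ∕ [III] Cor. 3 upper half `ρ_k ≤ e^{E₊|T₁^{(k)}|}` FOLLOWS FROM the EXPANSION-FREE ultraviolet-stability bound for the UNRENORMALISED averaged density, `I_k ≤ e^{E₊|T₁^{(k)}|}`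
everywhere, and — with law (i) too, under `Provisos₁₃SepCoPH` — §3 types ★★★ `ρ_k =ᵃᵉ I_k` (p583899's a.e. face `ρ_{j+1} =ᵃᵉ 𝐓ρ_j` + p613238 + the `HaarAC` a.e.-stability of the transports,
`transportOfRecord_congr_ae`): the (2.18) expansion and the 𝐑-step contribute nothing to the upper half there beyond monotonicity.  Print reaches
(2.50) for its 𝐑-RENORMALISED densities ((0.3) with nontrivial `Z′`, [IV] abstract ∕ p.175); a direct bound on `I_k` in d = 4 is not in print.  Nothing asserted or refuted; (U1) NOT
proved; Cor. 3 NOT proved; N13 NOT discharged; K0⁷ ∕ K1⁷ NOT closed; counts unmoved (discharged 5∕27 · Track A 5∕28).  ONE finite four-torus programme at fixed `ε = L^{−K}`; R4 closes the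
conditional finite-𝕋⁴ rung `BalabanLadder.UV` only — the Yang–Mills mass gap (Clay) is NOT proved by any of this; nothing continuum ∕ ℝ⁴ ∕ OS.  No `sorry`, `def`, `instance`, `notation`.

Sources: [Balaban1988Convergent] (2.18) p.257, Thm 1 p.262, Cor. 3 (2.50) p.264, (3.1) p.264, (3.25) p.270; [Balaban1989LargeFieldI] abstract, p.175, (0.2)–(0.4) p.176, (ii) p.177;
[Balaban1989LargeFieldII] Thm 1 + (0.1) pp.355–356; [Balaban1987RG1] (0.4) p.253 (the averaging).
-/

noncomputable section

open MeasureTheory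
open scoped BigOperators

namespace Summit.QuantumFields.YangMills.BalabanUVNodes.N13DensityBelowIteratedTransportOfDeadSelAtRecord13CoPH

open Literature.MathematicalPhysics.QuantumFieldTheory.Balaban1983to89
open T4Continuum Node00 B14.Eq218Concrete
open T4AveragingDisintegration (transportK kernelTransport avgKernel avgDensity)
open Summit.QuantumFields.YangMills.BalabanUVNodes.N13U1StepMajorantTowerAtRecord13CoPH (abs_transportOfRecord_le transportOfRecord_const_mul)
open Summit.QuantumFields.YangMills.BalabanUVNodes.N13TStepDensityIsTransportAtRecord13CoPH (tdensOfRecord₁₃_eq_transport_dens histTerm₁₃_nonneg abs_histTerm₁₃_le_of_dens_le)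
open Summit.QuantumFields.YangMills.BalabanUVNodes.N13RStepSubIdentityOfDeadSelAtRecord13CoPH (densOfRecord₁₃_succ_le_transport_dens_of_deadSel)
open Summit.QuantumFields.YangMills.Theorems.BalabanUVNodesN11TkOpMeasurable (measurable_kernelTransport)
open Summit.QuantumFields.YangMills.BalabanUVNodes.N13U1PieceTowerAtRecord13CoPH (transportOfRecord_mono)

variable (F : T4Family) (N : ℕ) [NeZero N]

/-! ## §1. The iterated one-step transport of `ρ₀` (a `Nat.rec` term): measurable, non-negative, bounded under version bounds (monotone transport: dag-n13-w6's `transportOfRecord_mono`) -/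

section Iterate

/-- The transport of record of a measurable function is measurable (dag-n11's `measurable_kernelTransport`, by name). [folklore] [cite: Balaban1985Averaging, (10) p.19 (bookkeeping)] -/
theorem measurable_transportOfRecord (K k : ℕ) {f : GaugeField (F.P K) k (SU N) → ℝ} (hf : Measurable f) :
    Measurable (transportOfRecord F N K k f) :=
  measurable_kernelTransport _ _ _ hf

/-- The transport of a function bounded by `C ≥ 0` in modulus is bounded by `C · avgDensity` pointwise. [folklore] [cite: Balaban1988Convergent, (3.1) p.264 (bookkeeping)] -/
theorem transportOfRecord_le_mul_avgDensity (K k : ℕ) {f : GaugeField (F.P K) k (SU N) → ℝ} {C : ℝ} (hf : ∀ U, |f U| ≤ C)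
    (V' : GaugeField (F.P K) (k + 1) (SU N)) :
    transportOfRecord F N K k f V' ≤ C * (avgDensity (avOfRecord F N K k).avg V' : ℝ) := by
  have hdom := abs_transportOfRecord_le F N K k (h := f) (H := fun _ => C) hf measurable_const (C := C) (fun _ => le_rfl) V'
  refine (le_abs_self _).trans (hdom.trans_eq ?_)
  have hc := transportOfRecord_const_mul F N K k C (fun _ => (1 : ℝ)) V'
  simp only [mul_one] at hc
  rw [hc]
  simp only [transportOfRecord, transportK, kernelTransport, integral_const, smul_eq_mul, probReal_univ, one_mul]
  ring

variable (θ : Stage13HParams F N) (P : B12.RunParams)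

/-- **THE ITERATED TRANSPORT OF `ρ₀` IS MEASURABLE AND NON-NEGATIVE** at every level (`I_0 = ρ₀ > 0` measurable; dag-n11's `measurable_kernelTransport`, def-T's `transportOfRecord_nonneg`).
The `Nat.rec` term is def-T's transports iterated from `ρ₀`; no definition is introduced. [cite: Balaban1988Convergent, Thm 1 p.262, (3.1) p.264; Balaban1987RG1, (0.4) p.253 (bookkeeping)] -/
theorem iterTransport_measurable_nonneg (k : ℕ) :
    Measurable (Nat.rec (motive := fun j => GaugeField (F.P P.K) j (SU N) → ℝ)
        (rhoZeroOfRecord F N P.K (gOfRecord₁₃ F N θ.toStage13Params P 0) (EOfRecord₁₃ F N θ.toStage13Params P))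
        (fun j I => transportOfRecord F N P.K j I) k) ∧
    (∀ V, 0 ≤ Nat.rec (motive := fun j => GaugeField (F.P P.K) j (SU N) → ℝ)
        (rhoZeroOfRecord F N P.K (gOfRecord₁₃ F N θ.toStage13Params P 0) (EOfRecord₁₃ F N θ.toStage13Params P))
        (fun j I => transportOfRecord F N P.K j I) k V) := by
  induction k with
  | zero => exact ⟨measurable_rhoZeroOfRecord F N P.K _ _, fun V => (rhoZeroOfRecord_pos F N P.K _ _ V).le⟩
  | succ k ih => exact ⟨measurable_transportOfRecord F N P.K k ih.1, fun V' => transportOfRecord_nonneg F N P.K k _ ih.2 V'⟩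

/-- **… AND BOUNDED BY `e^{−E(P)}·Π_{j<k} D_j` under everywhere marginal-density VERSION bounds `D_j`** (`I_0 = ρ₀ ≤ e^{−E}`, `rhoZeroOfRecord_le`; `I_{j+1} = T_j(I_j) ≤ (sup I_j)·avgDensity_j
≤ (sup I_j)·D_j`) — the plain sup road of p613238 for the iterate (no history count); any other everywhere bound on the `I_j` serves §2 equally. [cite: Balaban1988Convergent, Thm 1 p.262, (3.1) p.264 (bookkeeping)] -/
theorem iterTransport_le_of_avgDensity_le (k : ℕ) (D : ℕ → ℝ)
    (hD : ∀ j, j < k → ∀ V' : GaugeField (F.P P.K) (j + 1) (SU N), (avgDensity (avOfRecord F N P.K j).avg V' : ℝ) ≤ D j) :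
    ∀ V, Nat.rec (motive := fun j => GaugeField (F.P P.K) j (SU N) → ℝ)
        (rhoZeroOfRecord F N P.K (gOfRecord₁₃ F N θ.toStage13Params P 0) (EOfRecord₁₃ F N θ.toStage13Params P))
        (fun j I => transportOfRecord F N P.K j I) k V ≤ Real.exp (-EOfRecord₁₃ F N θ.toStage13Params P) * ∏ j ∈ Finset.range k, D j := by
  induction k with
  | zero =>
    intro V
    rw [Finset.range_zero, Finset.prod_empty, mul_one]
    exact rhoZeroOfRecord_le F N P.K _ _ V
  | succ k ih =>
    intro V'
    have hle := ih (fun j hj => hD j (Nat.lt_succ_of_lt hj))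
    have h0 := (iterTransport_measurable_nonneg F N θ P k).2
    have hB0 : 0 ≤ Real.exp (-EOfRecord₁₃ F N θ.toStage13Params P) * ∏ j ∈ Finset.range k, D j := by
      refine mul_nonneg (Real.exp_pos _).le (Finset.prod_nonneg fun j hj => ?_)
      have W : GaugeField (F.P P.K) (j + 1) (SU N) := fun _ => 1
      exact (NNReal.coe_nonneg _).trans (hD j (Nat.lt_succ_of_lt (Finset.mem_range.1 hj)) W)
    calc transportOfRecord F N P.K k _ V'
        ≤ (Real.exp (-EOfRecord₁₃ F N θ.toStage13Params P) * ∏ j ∈ Finset.range k, D j) * (avgDensity (avOfRecord F N P.K k).avg V' : ℝ) :=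
          transportOfRecord_le_mul_avgDensity F N P.K k (fun U => by rw [abs_of_nonneg (h0 U)]; exact hle U) V'
      _ ≤ (Real.exp (-EOfRecord₁₃ F N θ.toStage13Params P) * ∏ j ∈ Finset.range k, D j) * D k :=
          mul_le_mul_of_nonneg_left (hD k (Nat.lt_succ_self k) V') hB0
      _ = Real.exp (-EOfRecord₁₃ F N θ.toStage13Params P) * ∏ j ∈ Finset.range (k + 1), D j := by
          rw [Finset.prod_range_succ]; ring

end Iterate

/-! ## §2. ★★★ `ρ_k ≤ (T_{k−1} ∘ ⋯ ∘ T_0)(ρ₀)` at every field under law (ii) -/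

section Below

variable (θ : Stage13HParams F N) (P : B12.RunParams)

open Classical in
/-- **★★★ THE DENSITY OF RECORD LIES BELOW THE ITERATED TRANSPORT OF `ρ₀` AT EVERY FIELD** (every parameter with `Provisos₁₃CoPH` and the tree's selector law (ii) AS TYPED at the levels
`≤ k`): with ANY everywhere bounds on the iterates `I_j`, `j < k` (`hIbdd`: they make every fibre integral meaningful at every coarse field — e.g. `e^{−E(P)}·Π D_i` from version bounds,
`iterTransport_le_of_avgDensity_le`, or an ultraviolet-stability bound on `I_j` itself) and the MEASURABILITY of the history terms (K0c's theorem under (H-U); displayed), `ρ_k(V) ≤ I_k(V)` where `I_0 = ρ₀`, `I_{j+1} = T_j(I_j)` is def-T's one-step transport iterated (a version of the `k`-fold block-averaged Wilson–Gibbs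
density).  Proof: `ρ_{j+1} ≤ T_j(ρ_j)` (companion, law (ii) + p613238's `𝐓ρ_j = T_j(ρ_j)`, the boundedness of the level-`j` terms DISCHARGED from `ρ_j ≤ I_j ≤ B_j`) `≤ T_j(I_j)`
(monotone transport).  READING: at these parameters the (UV₁₃) upper half follows from the expansion-free bound `I_k ≤ e^{E₊|T₁^{(k)}|}` — print proves (2.50) for its 𝐑-renormalised densities
instead ([IV] abstract, p.175).  Nothing of Bałaban's asserted. [cite: Balaban1988Convergent, (2.18) p.257, Thm 1 p.262, Cor. 3 (2.50) p.264, (3.1) p.264; Balaban1989LargeFieldI, (0.3) p.176, (ii) p.177, p.175] -/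
theorem densOfRecord₁₃_le_iterTransport_of_deadSel (h : θ.Provisos₁₃CoPH F N) (k : ℕ) (hk : k ≤ P.K)
    (hdead : ∀ j, j < k → ∀ a : SeqOfRecord F θ.ν θ.τ9.M (gOfRecord₁₃ F N θ.toStage13Params P) P.K (j + 1), θ.ppSel P (gOfRecord₁₃ F N θ.toStage13Params P) (j + 1) a ≠ a →
      ∀ V, B15.BasicStep.fibreIntegral (fibOfSeq F θ.ν θ.τ9 P (gOfRecord₁₃ F N θ.toStage13Params P) (j + 1) a)
        (rterm (sliceOfRecord F N θ.ν θ.τ9.M P (gOfRecord₁₃ F N θ.toStage13Params P) (j + 1)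
          (slotsTOfRecord F N θ.ν θ.τ9 (EOfRecord₁₃ F N θ.toStage13Params) (wOfRecord₉ F N θ.toStage9Params) θ.ppSel P (gOfRecord₁₃ F N θ.toStage13Params P) (j + 1))) a) V = 0)
    (hIbdd : ∀ j, j < k → ∃ B : ℝ, ∀ V : GaugeField (F.P P.K) j (SU N),
      Nat.rec (motive := fun j => GaugeField (F.P P.K) j (SU N) → ℝ)
        (rhoZeroOfRecord F N P.K (gOfRecord₁₃ F N θ.toStage13Params P 0) (EOfRecord₁₃ F N θ.toStage13Params P))
        (fun j I => transportOfRecord F N P.K j I) j V ≤ B)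
    (hmeas : ∀ j, j < k → ∀ s : SeqOfRecord F θ.ν θ.τ9.M (gOfRecord₁₃ F N θ.toStage13Params P) P.K j,
      Measurable (fun U => chiSeqOfRecord F N θ.ν θ.τ9.M (gOfRecord₁₃ F N θ.toStage13Params P) P.K j s U *
        slotsOfRecord F N θ.ν θ.τ9 (EOfRecord₁₃ F N θ.toStage13Params) (wOfRecord₉ F N θ.toStage9Params) θ.ppSel P (gOfRecord₁₃ F N θ.toStage13Params P) j s U)) :
    ∀ V : GaugeField (F.P P.K) k (SU N),
      densOfRecord₁₃ F N θ.toStage13Params P k V ≤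
        Nat.rec (motive := fun j => GaugeField (F.P P.K) j (SU N) → ℝ)
          (rhoZeroOfRecord F N P.K (gOfRecord₁₃ F N θ.toStage13Params P 0) (EOfRecord₁₃ F N θ.toStage13Params P))
          (fun j I => transportOfRecord F N P.K j I) k V := by
  induction k with
  | zero =>
    intro V
    rw [densOfRecord₁₃_zero]
    show rhoZeroOfRecord F N P.K P.g0 _ V ≤ rhoZeroOfRecord F N P.K (gOfRecord₁₃ F N θ.toStage13Params P 0) _ V
    rw [show gOfRecord₁₃ F N θ.toStage13Params P 0 = P.g0 from FlowStepRuns.genSeq_zero _ _]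
  | succ k ih =>
    intro V'
    have hkK : k < P.K := Nat.lt_of_succ_le hk
    have ih' := ih hkK.le (fun j hj => hdead j (Nat.lt_succ_of_lt hj)) (fun j hj => hIbdd j (Nat.lt_succ_of_lt hj)) (fun j hj => hmeas j (Nat.lt_succ_of_lt hj))
    obtain ⟨hIm, hI0⟩ := iterTransport_measurable_nonneg F N θ P k
    obtain ⟨B, hIB⟩ := hIbdd k (Nat.lt_succ_self k)
    -- the level-k terms are bounded: `0 ≤ term ≤ ρ_k ≤ I_k ≤ B`
    have hρle : ∀ U, densOfRecord₁₃ F N θ.toStage13Params P k U ≤ B := fun U => (ih' U).trans (hIB U)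
    have hterm := abs_histTerm₁₃_le_of_dens_le F N θ P h k hρle
    have hρ0 : ∀ U, 0 ≤ densOfRecord₁₃ F N θ.toStage13Params P k U := fun U =>
      Finset.sum_nonneg fun s _ => histTerm₁₃_nonneg F N θ P h k s U
    calc densOfRecord₁₃ F N θ.toStage13Params P (k + 1) V'
        ≤ transportOfRecord F N P.K k (densOfRecord₁₃ F N θ.toStage13Params P k) V' :=
          densOfRecord₁₃_succ_le_transport_dens_of_deadSel F N θ P h k hkK (hdead k (Nat.lt_succ_self k)) (hmeas k (Nat.lt_succ_self k)) hterm V'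
      _ ≤ transportOfRecord F N P.K k _ V' :=
          transportOfRecord_mono F N P.K k hρ0 ih' hIm (C := B) hIB V'

end Below


/-! ## §3. ★★★ A.E. EQUALITY: under the selector laws (i)(ii) as typed, `ρ_k =ᵃᵉ (T_{k−1} ∘ ⋯ ∘ T_0)(ρ₀)` -/

section AeEq

/-- **THE TRANSPORT OF RECORD RESPECTS A.E. EQUALITY** (`k < K`, bounded measurable inputs): `f =ᵃᵉ g ⟹ T_k f =ᵃᵉ T_k g` — `|T_k f − T_k g| ≤ T_k|f − g|` pointwise (linearity + domination
on the probability kernel) and `∫ T_k|f − g| dV′ = ∫ |f − g| dU = 0` (def-T's `isRT_transportOfRecord` tested against `1`; `HaarAC` at `k < K`). [folklore]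
[cite: Balaban1988Convergent, (3.1) p.264; Balaban1987RG1, (0.4) p.253 (bookkeeping)] -/
theorem transportOfRecord_congr_ae (K k : ℕ) (hk : k < K) {f g : GaugeField (F.P K) k (SU N) → ℝ} (hfm : Measurable f) (hgm : Measurable g) {C : ℝ}
    (hfC : ∀ U, |f U| ≤ C) (hgC : ∀ U, |g U| ≤ C) (hfg : f =ᵐ[fieldMeasure (F.P K) k (SU N)] g) :
    transportOfRecord F N K k f =ᵐ[fieldMeasure (F.P K) (k + 1) (SU N)] transportOfRecord F N K k g := by
  set d : GaugeField (F.P K) k (SU N) → ℝ := fun U => |f U - g U| with hd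
  have hdm : Measurable d := (hfm.sub hgm).abs
  have hdC : ∀ U, |d U| ≤ 2 * C := fun U => by
    rw [hd]; dsimp only; rw [abs_abs]
    calc |f U - g U| ≤ |f U| + |g U| := abs_sub _ _
      _ ≤ C + C := add_le_add (hfC U) (hgC U)
      _ = 2 * C := by ring
  have hd0 : ∀ U, 0 ≤ d U := fun U => abs_nonneg _
  have hdint : Integrable d (fieldMeasure (F.P K) k (SU N)) :=
    Integrable.of_bound hdm.aestronglyMeasurable (2 * C) (Filter.Eventually.of_forall fun U => by rw [Real.norm_eq_abs]; exact hdC U)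
  -- (1) pointwise: `|T f − T g| ≤ T d`
  have h1 : ∀ V', |transportOfRecord F N K k f V' - transportOfRecord F N K k g V'| ≤ transportOfRecord F N K k d V' := by
    intro V'
    have hfi : Integrable f (avgKernel (avOfRecord F N K k).avg V') :=
      Integrable.of_bound hfm.aestronglyMeasurable C (Filter.Eventually.of_forall fun U => by rw [Real.norm_eq_abs]; exact hfC U)
    have hgi : Integrable g (avgKernel (avOfRecord F N K k).avg V') :=
      Integrable.of_bound hgm.aestronglyMeasurable C (Filter.Eventually.of_forall fun U => by rw [Real.norm_eq_abs]; exact hgC U)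
    have hsub : transportOfRecord F N K k f V' - transportOfRecord F N K k g V' = transportOfRecord F N K k (fun U => f U - g U) V' := by
      simp only [transportOfRecord, transportK, kernelTransport]
      rw [integral_sub hfi hgi]; ring
    rw [hsub]
    exact abs_transportOfRecord_le F N K k (h := fun U => f U - g U) (H := d) (fun U => le_rfl) hdm (C := 2 * C)
      (fun U => (le_abs_self _).trans (hdC U)) V'
  -- (2) `∫ T d = ∫ d = 0`, `T d ≥ 0` integrable ⟹ `T d =ᵃᵉ 0`
  have hRT := isRT_transportOfRecord F N K k hk d hdint (fun _ => (1 : ℝ)) measurable_const ⟨1, fun _ => by simp⟩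
  simp only [mul_one] at hRT
  have hdae : d =ᵐ[fieldMeasure (F.P K) k (SU N)] 0 := by
    filter_upwards [hfg] with U hU
    simp [hd, hU]
  have hint0 : ∫ V', transportOfRecord F N K k d V' ∂(fieldMeasure (F.P K) (k + 1) (SU N)) = 0 := by
    rw [hRT, integral_eq_zero_of_ae hdae]
  have hTint : Integrable (transportOfRecord F N K k d) (fieldMeasure (F.P K) (k + 1) (SU N)) :=
    T4AveragingDisintegration.integrable_kernelTransport _ _ (avOfRecord_measurable F N K k) (avOfRecord_haarAC F N K k hk) hdint
  have hTae : transportOfRecord F N K k d =ᵐ[fieldMeasure (F.P K) (k + 1) (SU N)] 0 :=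
    (integral_eq_zero_iff_of_nonneg_ae (Filter.Eventually.of_forall fun V' => transportOfRecord_nonneg F N K k d hd0 V') hTint).1 hint0
  filter_upwards [hTae] with V' hV'
  have := h1 V'
  rw [hV'] at this
  exact eq_of_abs_sub_nonpos this

variable (θ : Stage13HParams F N) (P : B12.RunParams)

open Classical in
/-- **★★★ THE DENSITY OF RECORD IS A.E. THE ITERATED TRANSPORT OF `ρ₀`** under `Provisos₁₃SepCoPH` and the tree's selector laws (i) `hidem`, (ii) `hdead` AS TYPED at the levels `≤ k`
(`k ≤ K`), with the rows of §2 (any everywhere bounds on the iterates `I_j` for the boundedness bookkeeping, measurability of the history terms): `ρ_k =ᵃᵉ I_k` for Haar measure at level `k` — by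
p583899's `ρ_{j+1} =ᵃᵉ 𝐓ρ_j` (`densOfRecord₁₃_succ_ae_eq_tdens_of_selLaws_sepCoPH`), p613238's `𝐓ρ_j = T_j(ρ_j)` and the a.e.-stability of `T_j`.  READING: on every parameter the node
files cover, the represented tower's density IS (a version of) the `k`-fold BLOCK-AVERAGED Wilson–Gibbs density; the (2.18) expansion with a law-abiding selector is a REPRESENTATION of it,
and (UV₁₃) there is expansion-free UV stability of that density — reached in print only through the nontrivial 𝐑 of [IV].  Nothing of Bałaban's asserted.
[cite: Balaban1989LargeFieldI, (0.2)–(0.4) p.176, (i)–(ii) p.177, abstract; Balaban1988Convergent, (2.18) p.257, Thm 1 p.262, (3.1) p.264] -/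
theorem densOfRecord₁₃_ae_eq_iterTransport_of_selLaws (h : θ.Provisos₁₃SepCoPH F N) (k : ℕ) (hk : k ≤ P.K)
    (hidem : ∀ j, j < k → ∀ a : SeqOfRecord F θ.ν θ.τ9.M (gOfRecord₁₃ F N θ.toStage13Params P) P.K (j + 1),
      θ.ppSel P (gOfRecord₁₃ F N θ.toStage13Params P) (j + 1) (θ.ppSel P (gOfRecord₁₃ F N θ.toStage13Params P) (j + 1) a)
        = θ.ppSel P (gOfRecord₁₃ F N θ.toStage13Params P) (j + 1) a)
    (hdead : ∀ j, j < k → ∀ a : SeqOfRecord F θ.ν θ.τ9.M (gOfRecord₁₃ F N θ.toStage13Params P) P.K (j + 1), θ.ppSel P (gOfRecord₁₃ F N θ.toStage13Params P) (j + 1) a ≠ a →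
      ∀ V, B15.BasicStep.fibreIntegral (fibOfSeq F θ.ν θ.τ9 P (gOfRecord₁₃ F N θ.toStage13Params P) (j + 1) a)
        (rterm (sliceOfRecord F N θ.ν θ.τ9.M P (gOfRecord₁₃ F N θ.toStage13Params P) (j + 1)
          (slotsTOfRecord F N θ.ν θ.τ9 (EOfRecord₁₃ F N θ.toStage13Params) (wOfRecord₉ F N θ.toStage9Params) θ.ppSel P (gOfRecord₁₃ F N θ.toStage13Params P) (j + 1))) a) V = 0)
    (hIbdd : ∀ j, j < k → ∃ B : ℝ, ∀ V : GaugeField (F.P P.K) j (SU N),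
      Nat.rec (motive := fun j => GaugeField (F.P P.K) j (SU N) → ℝ)
        (rhoZeroOfRecord F N P.K (gOfRecord₁₃ F N θ.toStage13Params P 0) (EOfRecord₁₃ F N θ.toStage13Params P))
        (fun j I => transportOfRecord F N P.K j I) j V ≤ B)
    (hmeas : ∀ j, j < k → ∀ s : SeqOfRecord F θ.ν θ.τ9.M (gOfRecord₁₃ F N θ.toStage13Params P) P.K j,
      Measurable (fun U => chiSeqOfRecord F N θ.ν θ.τ9.M (gOfRecord₁₃ F N θ.toStage13Params P) P.K j s U *
        slotsOfRecord F N θ.ν θ.τ9 (EOfRecord₁₃ F N θ.toStage13Params) (wOfRecord₉ F N θ.toStage9Params) θ.ppSel P (gOfRecord₁₃ F N θ.toStage13Params P) j s U)) :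
    densOfRecord₁₃ F N θ.toStage13Params P k =ᵐ[fieldMeasure (F.P P.K) k (SU N)]
      Nat.rec (motive := fun j => GaugeField (F.P P.K) j (SU N) → ℝ)
        (rhoZeroOfRecord F N P.K (gOfRecord₁₃ F N θ.toStage13Params P 0) (EOfRecord₁₃ F N θ.toStage13Params P))
        (fun j I => transportOfRecord F N P.K j I) k := by
  induction k with
  | zero =>
    refine Filter.Eventually.of_forall fun V => ?_
    rw [densOfRecord₁₃_zero]
    show rhoZeroOfRecord F N P.K P.g0 _ V = rhoZeroOfRecord F N P.K (gOfRecord₁₃ F N θ.toStage13Params P 0) _ V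
    rw [show gOfRecord₁₃ F N θ.toStage13Params P 0 = P.g0 from FlowStepRuns.genSeq_zero _ _]
  | succ k ih =>
    have hkK : k < P.K := Nat.lt_of_succ_le hk
    have ih' := ih hkK.le (fun j hj => hidem j (Nat.lt_succ_of_lt hj)) (fun j hj => hdead j (Nat.lt_succ_of_lt hj))
      (fun j hj => hIbdd j (Nat.lt_succ_of_lt hj)) (fun j hj => hmeas j (Nat.lt_succ_of_lt hj))
    obtain ⟨hIm, hI0⟩ := iterTransport_measurable_nonneg F N θ P k
    obtain ⟨B, hIle⟩ := hIbdd k (Nat.lt_succ_self k)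
    -- level-k bookkeeping: `ρ_k` measurable, `0 ≤ ρ_k ≤ I_k ≤ B`
    have hρle := densOfRecord₁₃_le_iterTransport_of_deadSel F N θ P h.toCore k hkK.le (fun j hj => hdead j (Nat.lt_succ_of_lt hj))
      (fun j hj => hIbdd j (Nat.lt_succ_of_lt hj)) (fun j hj => hmeas j (Nat.lt_succ_of_lt hj))
    have hB : ∀ U, densOfRecord₁₃ F N θ.toStage13Params P k U ≤ B := fun U => (hρle U).trans (hIle U)
    have hterm := abs_histTerm₁₃_le_of_dens_le F N θ P h.toCore k hB
    have hρ0 : ∀ U, 0 ≤ densOfRecord₁₃ F N θ.toStage13Params P k U := fun U =>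
      Finset.sum_nonneg fun s _ => histTerm₁₃_nonneg F N θ P h.toCore k s U
    have hρm : Measurable (densOfRecord₁₃ F N θ.toStage13Params P k) := by
      have : densOfRecord₁₃ F N θ.toStage13Params P k = fun U => ∑ s : SeqOfRecord F θ.ν θ.τ9.M (gOfRecord₁₃ F N θ.toStage13Params P) P.K k,
          chiSeqOfRecord F N θ.ν θ.τ9.M (gOfRecord₁₃ F N θ.toStage13Params P) P.K k s U *
            slotsOfRecord F N θ.ν θ.τ9 (EOfRecord₁₃ F N θ.toStage13Params) (wOfRecord₉ F N θ.toStage9Params) θ.ppSel P (gOfRecord₁₃ F N θ.toStage13Params P) k s U := rfl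
      rw [this]
      exact Finset.measurable_sum _ fun s _ => hmeas k (Nat.lt_succ_self k) s
    -- `ρ_{k+1} =ᵃᵉ 𝐓ρ_k = T_k(ρ_k) =ᵃᵉ T_k(I_k) = I_{k+1}`
    have h1 := B16RLeafRecord13SepCoPHSelLaws.densOfRecord₁₃_succ_ae_eq_tdens_of_selLaws_sepCoPH F N θ P h k hkK
      (hidem k (Nat.lt_succ_self k)) (hdead k (Nat.lt_succ_self k))
    have h2 : tdensOfRecord₁₃ F N θ.toStage13Params P k = transportOfRecord F N P.K k (densOfRecord₁₃ F N θ.toStage13Params P k) :=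
      funext (tdensOfRecord₁₃_eq_transport_dens F N θ P h.toCore k hkK (hmeas k (Nat.lt_succ_self k)) hterm)
    have h3 := transportOfRecord_congr_ae F N P.K k hkK hρm hIm (C := B)
      (fun U => by rw [abs_of_nonneg (hρ0 U)]; exact hB U) (fun U => by rw [abs_of_nonneg (hI0 U)]; exact hIle U) ih'
    rw [h2] at h1
    exact h1.trans h3

end AeEq

end Summit.QuantumFields.YangMills.BalabanUVNodes.N13DensityBelowIteratedTransportOfDeadSelAtRecord13CoPH

end
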